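import Literature.NumberTheory.Transcendental.KZKernelConjectureForms
import HarnessLib
import HarnessLib.Audit

/-!
# The volume form of the Kontsevich–Zagier period conjecture (Viu-Sos, Cresson–Viu-Sos)

Named facts and one printed open conjecture around the *geometric* reading of Conjecture 1 of
[Kontsevich–Zagier 2001, §1.2] over the calculus of moves of `KZCalculus.lean`
(`KZ.IntegralRep`, `KZ.relations`, `KZ.Equivalent`).

Sources read (materialised pages, `lit read 10.5802/jtnb.1204`, pp. 4–5 of the file = printed
pp. 325–326):

* J. Viu-Sos, *A semi-canonical reduction for periods of Kontsevich–Zagier*, Int. J. Number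
  Theory 17 (2021) 147–174 [ViuSos2021], **Thm. 1.1** (quoted verbatim in [CressonViusos2022,
  §1, p. 325]): "Let `p` be a non-zero real period given in a certain integral form `I(S, P/Q)`
  in `ℝ^d` as in (1.1). There exists an effective algorithm only using the KZ-rules such that
  `I(S, P/Q)` can be rewritten as `I(S, P/Q) = sgn(p) · vol_m(K)`, where `K ⊂ ℝ^m` is a compact
  top-dimensional semi-algebraic set and `vol_m(·)` is the canonical volume in `ℝ^m`, for some
  `0 < m ≤ d + 1`." — vendored as `KZ.semiCanonicalReduction`.
* J. Cresson, J. Viu-Sos, *On the equality of periods of Kontsevich–Zagier*, J. Théor. Nombres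
  Bordeaux 34 (2022) 323–343 [CressonViusos2022], §1, p. 326: "As a consequence, the
  Kontsevich–Zagier conjecture is equivalent to: **Conjecture.** Let `K₁` and `K₂` be two compact
  top-dimensional semialgebraic sets in `ℝ^d` such that `vol_d(K₁) = vol_d(K₂)`. Then we can pass
  from one formulation to the other one by only using transformations respecting the KZ-rules."
  — the conjecture is `KZ.volumeConjectureCompact` (OPEN, a `def`), the printed equivalence with
  Conjecture 1 is the named fact `KZ.kzPeriodConjecture'_iff_volumeConjectureCompact`.

## What is here

* `KZ.volumeConjectureCompact` — the printed conjecture ("volume is the only KZ-invariant of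
  compact top-dimensional `ℚ`-semialgebraic sets"), over `KZ.IntegralRep d` with integrand `1`
  on the domain (so that `value = vol_d`); top-dimensional = non-empty interior.
* `KZ.semiCanonicalReduction` — Viu-Sos' Thm. 1.1 as printed, for representations of KZ's
  literal shape (`IsRational`): `[r] ∓ [K] ∈ relations` according to the sign of the value.
* `KZ.kzPeriodConjecture'_iff_volumeConjectureCompact` — the printed equivalence
  (two-representation form `KZPeriodConjecture'` of `PeriodConjecture.lean`, itself equivalent to
  the kernel form and to the `IsRational` form by `KZKernelConjectureForms.lean`).
* `KZ.volumeConjectureCompact_of_kzPeriodConjecture'` — the trivial direction, PROVED (the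
  volume conjecture is a special case of the two-representation form).

Grounds `Summit.KontsevichZagierPeriods.KontsevichZagierPeriods.Theses.HardSphereVirial.VolumeForm`
and `….Theses.SphericalSchlafli.VolumeForm` (shared item; the route statement drops "compact" and
"top-dimensional" and fixes one common dimension, so it is formally STRONGER than the printed
conjecture and implies it in one line) and `….HardSphereVirial.Assembly` /
`….SphericalSchlafli.Assembly` (`VolumeForm → KontsevichZagierPeriods`: with
`semiCanonicalReduction` as hypothesis, or directly by the subgraph/slab/glue tools of
`KZCalculusProofs.lean`).

## What is NOT here

No proof of Thm. 1.1 (compactification of the domain is `PeriodCompactDomain.lean`; the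
resolution-of-poles half, [ViuSos2021, Prop. 2.2 / Cor. 2.2], is not in the tree), no GKZ
Grothendieck-ring formulation [CressonViusos2022, Conj. 1.1, §2], no PL version (Conj. 1.2).

## References

* [KontsevichZagier2001] M. Kontsevich, D. Zagier, *Periods*, Springer (2001), §1.2, Conjecture 1.
* [ViuSos2021] J. Viu-Sos, IJNT 17 (2021) 147–174, Thm. 1.1 (arXiv:1509.01097).
* [CressonViusos2022] J. Cresson, J. Viu-Sos, JTNB 34 (2022) 323–343, §1 (pp. 325–326).
-/

noncomputable section

namespace Literature.NumberTheory.Transcendental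

namespace KZ

/-- OPEN CONJECTURE — the **volume form of the Kontsevich–Zagier period conjecture**
[Cresson–Viu-Sos 2022, §1, p. 326, unnumbered "Conjecture"]: "Let `K₁` and `K₂` be two compact
top-dimensional semialgebraic sets in `ℝ^d` such that `vol_d(K₁) = vol_d(K₂)`. Then we can pass
from one formulation to the other one by only using transformations respecting the KZ-rules."
Here a "formulation" is the integral representation `I(K, 1) = ∫_K 1` (an `IntegralRep d` with
integrand `1` on its domain, whose `value` is `vol_d(K)`), "top-dimensional" is read as
"non-empty interior" (equivalent for semialgebraic sets), and "passing by the KZ-rules" is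
`KZ.Equivalent` of `KZCalculus.lean`. Printed there as EQUIVALENT to Conjecture 1 of
Kontsevich–Zagier (fact `kzPeriodConjecture'_iff_volumeConjectureCompact`); open.
[cite: CressonViusos2022, §1 p. 326 Conjecture] -/
@[conjecture] def volumeConjectureCompact : Prop :=
  ∀ ⦃d : ℕ⦄ (r r' : IntegralRep d),
    IsCompact r.domain → (interior r.domain).Nonempty →
    IsCompact r'.domain → (interior r'.domain).Nonempty →
    (∀ x ∈ r.domain, r.integrand x = 1) → (∀ x ∈ r'.domain, r'.integrand x = 1) →
    r.value = r'.value → Equivalent r r'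

/-- **Viu-Sos' semi-canonical reduction** [Viu-Sos 2021, Thm. 1.1; quoted in Cresson–Viu-Sos
2022, §1, p. 325]: "Let `p` be a non-zero real period given in a certain integral form
`I(S, P/Q)` in `ℝ^d` as in (1.1)" (an absolutely convergent integral of a quotient of
`ℚ`-polynomials over a `ℚ`-semialgebraic domain: `IntegralRep.IsRational`). "There exists an
effective algorithm only using the KZ-rules such that `I(S, P/Q)` can be rewritten as
`I(S, P/Q) = sgn(p) · vol_m(K)`, where `K ⊂ ℝ^m` is a compact top-dimensional semi-algebraic set
and `vol_m(·)` is the canonical volume in `ℝ^m`, for some `0 < m ≤ d + 1`." Read over the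
calculus of `KZCalculus.lean`: `[r] − [K] ∈ relations` if `p > 0` and `[r] + [K] ∈ relations`
if `p < 0`, with `K` an integrand-`1` representation on a compact domain with non-empty interior.
(Proof in print: compactification by projective charts, §2.2, and Hironaka's embedded resolution
to separate the poles from the boundary, §2.3; not formalised.)
[cite: ViuSos2021, Thm. 1.1] -/
def semiCanonicalReduction : Prop :=
  ∀ ⦃d : ℕ⦄ (r : IntegralRep d), r.IsRational → r.value ≠ 0 →
    ∃ (m : ℕ) (K : IntegralRep m), 0 < m ∧ m ≤ d + 1 ∧ IsCompact K.domain ∧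
      (interior K.domain).Nonempty ∧ (∀ x ∈ K.domain, K.integrand x = 1) ∧
      (0 < r.value → of r - of K ∈ relations) ∧ (r.value < 0 → of r + of K ∈ relations)

/-- **Conjecture 1 ⇔ its volume form** [Cresson–Viu-Sos 2022, §1, p. 326]: "As a consequence"
(of the semi-canonical reduction, `semiCanonicalReduction`, and of the definition (1.2) of the
equivalence `∼_KZ` of representations) "the Kontsevich–Zagier conjecture is equivalent to" the
volume conjecture `volumeConjectureCompact`. The Kontsevich–Zagier conjecture is taken in its
two-representation form `KZPeriodConjecture'` of `PeriodConjecture.lean` (equivalent to the kernel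
form `KZKernelConjecture` and to the `IsRational`-endpoint form = the summit statement, by
`kzKernelConjecture_iff_kzPeriodConjecture'`, `kzPeriodConjecture'_iff_isRational`). The direction
`→` is `volumeConjectureCompact_of_kzPeriodConjecture'` below; `←` is the printed consequence of
Viu-Sos' Thm. 1.1 (plus the zero-period case) and is NOT proved here.
[cite: CressonViusos2022, §1 p. 326] -/
def kzPeriodConjecture'_iff_volumeConjectureCompact : Prop :=
  KZPeriodConjecture' ↔ volumeConjectureCompact

/-- The trivial half of `kzPeriodConjecture'_iff_volumeConjectureCompact`: the volume conjecture
is the special case of the two-representation form of Conjecture 1 in which both representations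
have integrand `1` on compact top-dimensional domains of one dimension.
[cite: CressonViusos2022, §1 p. 326] -/
theorem volumeConjectureCompact_of_kzPeriodConjecture' (h : KZPeriodConjecture') :
    volumeConjectureCompact := by
  intro d r r' _ _ _ _ _ _ hv
  exact h r r' hv

end KZ

end Literature.NumberTheory.Transcendental
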